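import Mathlib
import Literature.Computability.AlgebraicComplexity.DeterminantalConormalBound

/-!
# Crux `DetQP.DetqpSuperquadratic` (stmt-ValiantsHypothesis-0318), line `sectional-class-ladder` —
stub `stub_polarPersistence`: persistence of non-degenerate polar points (lower semicontinuity
of the polar count)

The line counts, for a form `g` in `N` variables and a pencil/chart datum `u = (a, b, c) ∈ (ℂ^N)³`
(encoded `u : Fin 3 × Fin N → ℂ`, rows `0, 1, 2 = a, b, c`), the points of the polar set
`T_g(a, b, c)` (`Literature.Computability.AlgebraicComplexity.polarSet`: `g(x) = 0`, `∇g(x) ≠ 0`,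
`∇g(x) ∈ ℂa + ℂb`, `c · x = 1`).  This file proves the registered stub

* `stub_polarPersistence` : if at one datum `(a, b, c)` the polar set contains a finite set `F`
  of points at which the bordered-Hessian Jacobian `[[∂ᵢ∂ⱼg(x), (aᵢ bᵢ)], [(∂ⱼg(x); cⱼ), 0]]` is
  invertible, then off every hypersurface `Φ = 0` of the data space there is a datum whose polar
  set has at least `|F|` points.

**Proof.**  A polar point `x` with its multipliers `(s, t)` (`∇g(x) = s a + t b`) gives a zero
`(x, s', t') = (x, -s, -t)` of the SQUARE polynomial system in the unknowns
`z = (x, s', t') ∈ ℂ^N × ℂ²` (indexed by `Fin N ⊕ Fin 2`) with parameters `u`,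
`G(u; z) = ((∂ᵢg(x) + s' aᵢ + t' bᵢ)_{i<N}, g(x), Σⱼ cⱼxⱼ)`, with values `(0, 0, 1)`; its Jacobian
`∂G/∂z` at such a zero is literally the displayed block matrix (the sign change `s' = -s` absorbs
the sign of the two multiplier columns; `∂ᵢ∂ⱼ = ∂ⱼ∂ᵢ`, `PolarPersistence.pderiv_pderiv_comm`).
Polynomial maps are strictly differentiable with the gradient as derivative
(`PolarPersistence.hasStrictFDerivAt_eval`, induction on the polynomial), so Mathlib's implicit
function theorem on a product domain (`HasStrictFDerivAt.implicitFunctionOfProdDomain`; the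
partial derivative is invertible by `ContinuousLinearMap.toContinuousLinearEquivOfDetNeZero`,
its matrix being the hypothesis' matrix) continues each `x ∈ F` to a branch `u ↦ x(u)` of zeros,
`x(u) → x`, hence of polar points of the datum `u` for `u` near `u₀ = (a, b, c)` (`∇g ≠ 0` is an
open condition) — `PolarPersistence.exists_branch`.  Finitely many branches with distinct limits
stay pairwise distinct near `u₀`, so the polar count is `≥ |F|` on a neighbourhood of `u₀`; and
`{Φ ≠ 0}` meets every neighbourhood, because a polynomial vanishing on a ball of `(ℂ^N)³` (a box
with infinite sides) is zero (`MvPolynomial.funext_set`) —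
`PolarPersistence.frequently_eval_ne_zero`.  The case `F = ∅` is covered by the same argument.
Everything is over `ℂ` except the derivative lemma (any nontrivially normed field) and the
commutation of partial derivatives (any commutative semiring).  No new definitions; self-contained
on Mathlib and the Literature entry `DeterminantalConormalBound` (`polarSet`, `mem_polarSet`).
-/

noncomputable section

-- `Summit.ValiantsHypothesis.ValiantsHypothesis.…` is the tree's mandated single-conjunct layout
-- (Sub = Summit), so the duplicated namespace component is intended.
set_option linter.dupNamespace false

namespace Summit.ValiantsHypothesis.ValiantsHypothesis.Theorems.DetQPDetqpSuperquadratic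

open MvPolynomial Filter Topology
open Literature.Computability.AlgebraicComplexity

namespace PolarPersistence

/-- Mixed partial derivatives of polynomials commute: `∂ᵢ ∂ⱼ p = ∂ⱼ ∂ᵢ p` (any commutative
semiring of coefficients). [folklore] -/
theorem pderiv_pderiv_comm {σ R : Type*} [CommSemiring R] (i j : σ) (p : MvPolynomial σ R) :
    pderiv i (pderiv j p) = pderiv j (pderiv i p) := by
  -- adapted from Literature/Algebra/Polynomial/FischerInnerProduct.lean (`pderiv_pderiv_comm`)
  classical
  induction p using MvPolynomial.induction_on with
  | C a => simp
  | add p q hp hq => simp [map_add, hp, hq]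
  | mul_X p k h =>
    simp only [pderiv_mul, map_add, h, pderiv_X]
    by_cases hik : i = k <;> by_cases hjk : j = k <;> simp [hik, hjk]

/-- **Polynomial maps are strictly differentiable, the derivative being the gradient pairing**:
for `p ∈ 𝕜[x_σ]` (`σ` finite, `𝕜` a nontrivially normed field) the evaluation map `x ↦ p(x)` on
`𝕜^σ` has strict Fréchet derivative `v ↦ Σᵢ ∂ᵢp(x) vᵢ` at every point `x` (induction on `p`:
constants, sums, and the Leibniz rule for `p · Xᵢ`). [folklore] -/
theorem hasStrictFDerivAt_eval {𝕜 σ : Type*} [NontriviallyNormedField 𝕜] [Fintype σ]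
    (p : MvPolynomial σ 𝕜) (x : σ → 𝕜) :
    HasStrictFDerivAt (fun y : σ → 𝕜 => eval y p)
      (∑ i, eval x (pderiv i p) • (ContinuousLinearMap.proj i : (σ → 𝕜) →L[𝕜] 𝕜)) x := by
  classical
  induction p using MvPolynomial.induction_on with
  | C a =>
    simp only [eval_C]
    refine (hasStrictFDerivAt_const a x).congr_fderiv ?_
    ext v
    simp
  | add p q hp hq =>
    simp only [map_add]
    refine (hp.fun_add hq).congr_fderiv ?_
    ext v
    simp [Finset.sum_add_distrib, add_mul]
  | mul_X p i hp =>
    simp only [map_mul, eval_X]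
    refine (hp.fun_mul (hasStrictFDerivAt_apply i x)).congr_fderiv ?_
    ext v
    have h1 : ∀ j, eval x (pderiv j (p * X i)) =
        eval x (pderiv j p) * x i + (if j = i then eval x p else 0) := by
      intro j
      rw [pderiv_mul, map_add, map_mul, map_mul, eval_X]
      rcases eq_or_ne j i with rfl | hji
      · simp
      · simp [pderiv_X_of_ne (Ne.symm hji), hji]
    simp only [add_apply, FunLike.coe_smul, Pi.smul_apply, FunLike.coe_sum, Finset.sum_apply,
      ContinuousLinearMap.proj_apply, smul_eq_mul, h1, add_mul, Finset.sum_add_distrib, ite_mul,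
      zero_mul, Finset.sum_ite_eq', Finset.mem_univ, if_true, Finset.mul_sum]
    rw [add_comm]
    congr 1
    exact Finset.sum_congr rfl fun j _ => by ring

/-- A non-zero polynomial over `ℂ` is non-zero at points arbitrarily close to any given point
(a polynomial vanishing on a neighbourhood vanishes on a box with infinite sides, hence is `0`,
`MvPolynomial.funext_set`). [folklore] -/
theorem frequently_eval_ne_zero {σ : Type*} [Fintype σ] (Φ : MvPolynomial σ ℂ) (hΦ : Φ ≠ 0)
    (u₀ : σ → ℂ) : ∃ᶠ u in 𝓝 u₀, eval u Φ ≠ 0 := by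
  by_contra h
  simp only [Filter.not_frequently, not_not] at h
  obtain ⟨ε, hε, hball⟩ := Metric.eventually_nhds_iff_ball.1 h
  refine hΦ (MvPolynomial.funext_set (fun k => Metric.ball (u₀ k) ε)
    (fun k => infinite_of_mem_nhds (u₀ k) (Metric.ball_mem_nhds _ hε)) fun x hx => ?_)
  rw [map_zero]
  refine hball x ?_
  rw [ball_pi _ hε]
  exact hx

/-- **Persistence of one non-degenerate polar point** (implicit function theorem).  Let
`x₀ ∈ T_g(a, b, c)` be a polar point at the datum `u₀ = (a, b, c)` at which the bordered-Hessian
Jacobian `[[∂ᵢ∂ⱼg(x₀), (aᵢ bᵢ)], [(∂ⱼg(x₀); cⱼ), 0]]` is invertible.  Then there is a branch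
`φ : (ℂ^N)³ → ℂ^N`, `φ(u) → x₀` as `u → u₀`, with `φ(u) ∈ T_g(u)` for all `u` near `u₀`.
Proof: `(x₀, -s, -t)` is a zero of the square polynomial system
`G(u; x, s', t') = ((∂ᵢg(x) + s'aᵢ + t'bᵢ)ᵢ, g(x), Σ cⱼxⱼ)` (values `(0, 0, 1)`), strictly
differentiable in `(u, x, s', t')` with `∂G/∂(x, s', t')` the displayed matrix; apply
`HasStrictFDerivAt.implicitFunctionOfProdDomain`, and keep `∇g ≠ 0` by continuity. [folklore] -/
theorem exists_branch {N : ℕ} (g : MvPolynomial (Fin N) ℂ) (u₀ : Fin 3 × Fin N → ℂ)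
    (x₀ : Fin N → ℂ)
    (hx₀ : x₀ ∈ polarSet g (fun i => u₀ (0, i)) (fun i => u₀ (1, i)) (fun i => u₀ (2, i)))
    (hdet : (Matrix.fromBlocks
        (Matrix.of fun i j : Fin N => eval x₀ (pderiv i (pderiv j g)))
        (Matrix.of fun (i : Fin N) (l : Fin 2) => ![u₀ (0, i), u₀ (1, i)] l)
        (Matrix.of fun (l : Fin 2) (j : Fin N) => ![eval x₀ (pderiv j g), u₀ (2, j)] l)
        (0 : Matrix (Fin 2) (Fin 2) ℂ)).det ≠ 0) :
    ∃ φ : (Fin 3 × Fin N → ℂ) → (Fin N → ℂ), Tendsto φ (𝓝 u₀) (𝓝 x₀) ∧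
      ∀ᶠ u in 𝓝 u₀,
        φ u ∈ polarSet g (fun i => u (0, i)) (fun i => u (1, i)) (fun i => u (2, i)) := by
  classical
  obtain ⟨hg0, ⟨i₀, hi₀⟩, ⟨s₀, t₀, hst⟩, hchart⟩ := hx₀
  simp only at hst hchart
  -- base point of the unknowns `z = (x, s', t')` (`s' = -s`, `t' = -t`)
  set z₀ : Fin N ⊕ Fin 2 → ℂ := Sum.elim x₀ ![-s₀, -t₀]
  have hz₀l : ∀ j, z₀ (Sum.inl j) = x₀ j := fun j => rfl
  have hz₀0 : z₀ (Sum.inr 0) = -s₀ := rfl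
  have hz₀1 : z₀ (Sum.inr 1) = -t₀ := rfl
  -- restriction `z ↦ x`
  set R : (Fin N ⊕ Fin 2 → ℂ) →L[ℂ] (Fin N → ℂ) :=
    ContinuousLinearMap.pi fun j => ContinuousLinearMap.proj (Sum.inl j)
  have hRv : ∀ (w : Fin N ⊕ Fin 2 → ℂ) (j : Fin N), R w j = w (Sum.inl j) := fun w j => rfl
  have hRz₀ : R z₀ = x₀ := funext fun j => rfl
  -- the Jacobian of the hypothesis
  set M : Matrix (Fin N ⊕ Fin 2) (Fin N ⊕ Fin 2) ℂ := Matrix.fromBlocks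
      (Matrix.of fun i j : Fin N => eval x₀ (pderiv i (pderiv j g)))
      (Matrix.of fun (i : Fin N) (l : Fin 2) => ![u₀ (0, i), u₀ (1, i)] l)
      (Matrix.of fun (l : Fin 2) (j : Fin N) => ![eval x₀ (pderiv j g), u₀ (2, j)] l)
      (0 : Matrix (Fin 2) (Fin 2) ℂ)
  -- the square system, componentwise, on `parameters × unknowns`
  set Gc : Fin N ⊕ Fin 2 → (Fin 3 × Fin N → ℂ) × (Fin N ⊕ Fin 2 → ℂ) → ℂ :=
    Sum.elim (fun i w => eval (R w.2) (pderiv i g) + w.2 (Sum.inr 0) * w.1 (0, i) +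
        w.2 (Sum.inr 1) * w.1 (1, i))
      ![fun w => eval (R w.2) g, fun w => ∑ j, w.1 (2, j) * w.2 (Sum.inl j)]
  have eGl : ∀ i, Gc (Sum.inl i) = fun w => eval (R w.2) (pderiv i g) +
      w.2 (Sum.inr 0) * w.1 (0, i) + w.2 (Sum.inr 1) * w.1 (1, i) := fun i => rfl
  have eG0 : Gc (Sum.inr 0) = fun w => eval (R w.2) g := rfl
  have eG1 : Gc (Sum.inr 1) = fun w => ∑ j, w.1 (2, j) * w.2 (Sum.inl j) := rfl
  -- strict derivatives of the building blocks at `(u₀, z₀)`: coordinates and `w ↦ q(x)`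
  set pu : Fin 3 × Fin N → ((Fin 3 × Fin N → ℂ) × (Fin N ⊕ Fin 2 → ℂ) →L[ℂ] ℂ) :=
    fun k => (ContinuousLinearMap.proj k).comp (ContinuousLinearMap.fst ℂ _ _)
  set pz : Fin N ⊕ Fin 2 → ((Fin 3 × Fin N → ℂ) × (Fin N ⊕ Fin 2 → ℂ) →L[ℂ] ℂ) :=
    fun k => (ContinuousLinearMap.proj k).comp (ContinuousLinearMap.snd ℂ _ _)
  have hpu : ∀ k, HasStrictFDerivAt
      (fun w : (Fin 3 × Fin N → ℂ) × (Fin N ⊕ Fin 2 → ℂ) => w.1 k) (pu k) (u₀, z₀) :=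
    fun k => (pu k).hasStrictFDerivAt
  have hpz : ∀ k, HasStrictFDerivAt
      (fun w : (Fin 3 × Fin N → ℂ) × (Fin N ⊕ Fin 2 → ℂ) => w.2 k) (pz k) (u₀, z₀) :=
    fun k => (pz k).hasStrictFDerivAt
  have hpuv : ∀ k w, pu k w = w.1 k := fun k w => rfl
  have hpzv : ∀ k w, pz k w = w.2 k := fun k w => rfl
  have hev : ∀ q : MvPolynomial (Fin N) ℂ, HasStrictFDerivAt
      (fun w : (Fin 3 × Fin N → ℂ) × (Fin N ⊕ Fin 2 → ℂ) => eval (R w.2) q)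
      ((∑ j, eval x₀ (pderiv j q) • (ContinuousLinearMap.proj j : (Fin N → ℂ) →L[ℂ] ℂ)).comp
        (R.comp (ContinuousLinearMap.snd ℂ _ _))) (u₀, z₀) := by
    intro q
    have h := hasStrictFDerivAt_eval q (R (u₀, z₀).2)
    rw [show R (u₀, z₀).2 = x₀ from hRz₀] at h
    exact h.comp (u₀, z₀) (R.comp (ContinuousLinearMap.snd ℂ _ _)).hasStrictFDerivAt
  -- each component is strictly differentiable, with `z`-partial the corresponding row of `M`
  have hcomp : ∀ k, ∃ E : (Fin 3 × Fin N → ℂ) × (Fin N ⊕ Fin 2 → ℂ) →L[ℂ] ℂ,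
      HasStrictFDerivAt (Gc k) E (u₀, z₀) ∧ ∀ v, E (0, v) = (M.mulVec v) k := by
    rintro (i | l)
    · rw [eGl i]
      refine ⟨_, ((hev (pderiv i g)).fun_add ((hpz _).fun_mul (hpu _))).fun_add
        ((hpz _).fun_mul (hpu _)), fun v => ?_⟩
      simp [hRv, hpuv, hpzv, hz₀0, hz₀1, M, Matrix.mulVec, dotProduct, Fintype.sum_sum_type,
        Fin.sum_univ_two, pderiv_pderiv_comm _ i g]
      ring
    · revert l
      rw [Fin.forall_fin_two]
      refine ⟨?_, ?_⟩
      · rw [eG0]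
        refine ⟨_, hev g, fun v => ?_⟩
        simp [hRv, M, Matrix.mulVec, dotProduct, Fintype.sum_sum_type]
      · rw [eG1]
        refine ⟨_, HasStrictFDerivAt.fun_sum fun j _ => (hpu (2, j)).fun_mul (hpz (Sum.inl j)),
          fun v => ?_⟩
        simp [hpuv, hpzv, hz₀l, M, Matrix.mulVec, dotProduct, Fintype.sum_sum_type]
  choose E hE hEv using hcomp
  have hG : HasStrictFDerivAt (fun w k => Gc k w) (ContinuousLinearMap.pi E) (u₀, z₀) :=
    hasStrictFDerivAt_pi.2 hE
  -- the partial derivative in the unknowns is `M`, hence invertible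
  set T := (ContinuousLinearMap.pi E).comp
    (ContinuousLinearMap.inr ℂ (Fin 3 × Fin N → ℂ) (Fin N ⊕ Fin 2 → ℂ))
  have hTM : (T : (Fin N ⊕ Fin 2 → ℂ) →ₗ[ℂ] (Fin N ⊕ Fin 2 → ℂ)) = Matrix.toLin' M := by
    refine LinearMap.ext fun v => funext fun k => ?_
    rw [Matrix.toLin'_apply]
    exact hEv k v
  have hdetT : T.det ≠ 0 := by
    change LinearMap.det (T : (Fin N ⊕ Fin 2 → ℂ) →ₗ[ℂ] (Fin N ⊕ Fin 2 → ℂ)) ≠ 0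
    rw [hTM, LinearMap.det_toLin']
    exact hdet
  have hinv : T.IsInvertible :=
    ⟨T.toContinuousLinearEquivOfDetNeZero hdetT,
      ContinuousLinearMap.coe_toContinuousLinearEquivOfDetNeZero T hdetT⟩
  -- the implicit function `ψ : u ↦ z(u)` and the branch `φ = R ∘ ψ`
  set ψ := hG.implicitFunctionOfProdDomain hinv
  have hψt : Tendsto ψ (𝓝 u₀) (𝓝 z₀) := hG.tendsto_implicitFunctionOfProdDomain hinv
  have hψe : ∀ᶠ u in 𝓝 u₀, (fun k => Gc k (u, ψ u)) = fun k => Gc k (u₀, z₀) :=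
    hG.eventually_apply_implicitFunctionOfProdDomain hinv
  have hRψ : Tendsto (fun u => R (ψ u)) (𝓝 u₀) (𝓝 x₀) := by
    rw [← hRz₀]
    exact (R.continuous.tendsto z₀).comp hψt
  refine ⟨fun u => R (ψ u), hRψ, ?_⟩
  have hgrad : ∀ᶠ u in 𝓝 u₀, eval (R (ψ u)) (pderiv i₀ g) ≠ 0 :=
    (((continuous_eval (pderiv i₀ g)).tendsto x₀).comp hRψ).eventually_ne hi₀
  filter_upwards [hψe, hgrad] with u hu hgu
  have h1 : ∀ i, Gc (Sum.inl i) (u, ψ u) = Gc (Sum.inl i) (u₀, z₀) :=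
    fun i => congr_fun hu (Sum.inl i)
  have h2 : Gc (Sum.inr 0) (u, ψ u) = Gc (Sum.inr 0) (u₀, z₀) := congr_fun hu (Sum.inr 0)
  have h3 : Gc (Sum.inr 1) (u, ψ u) = Gc (Sum.inr 1) (u₀, z₀) := congr_fun hu (Sum.inr 1)
  rw [eG0] at h2
  rw [eG1] at h3
  simp only [hRz₀, hz₀l] at h2 h3
  refine mem_polarSet.2 ⟨h2.trans hg0, ⟨i₀, hgu⟩,
    ⟨-ψ u (Sum.inr 0), -ψ u (Sum.inr 1), fun i => ?_⟩, ?_⟩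
  · have h1i := h1 i
    simp only [eGl, hRz₀, hz₀0, hz₀1, hst i] at h1i
    linear_combination h1i
  · simp only [hRv]
    exact h3.trans hchart

end PolarPersistence

open PolarPersistence in
/-- **Registered sub-goal `stub_polarPersistence` — persistence of non-degenerate polar points
(lower semicontinuity of the polar count).**  If at one datum `(a, b, c)` the polar set of `g`
contains a finite set `F` of non-degenerate zeros of the square polar system (bordered-Hessian
Jacobian invertible), then off every hypersurface `Φ = 0` of the data space `(ℂ^N)³` there is a
datum whose polar set contains at least `|F|` points.  Proof: each `x ∈ F` continues to a branch
`φₓ(u) ∈ T_g(u)` with `φₓ(u) → x` (`PolarPersistence.exists_branch`); near `u₀ = (a, b, c)` the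
finitely many branches stay pairwise distinct, and `{Φ ≠ 0}` meets every neighbourhood of `u₀`
(`PolarPersistence.frequently_eval_ne_zero`). [folklore] -/
theorem stub_polarPersistence {N : ℕ} (g : MvPolynomial (Fin N) ℂ) (a b c : Fin N → ℂ)
    (F : Finset (Fin N → ℂ))
    (hF : ∀ x ∈ F, x ∈ polarSet g a b c ∧
      (Matrix.fromBlocks
        (Matrix.of fun i j : Fin N => eval x (pderiv i (pderiv j g)))
        (Matrix.of fun (i : Fin N) (l : Fin 2) => ![a i, b i] l)
        (Matrix.of fun (l : Fin 2) (j : Fin N) => ![eval x (pderiv j g), c j] l)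
        (0 : Matrix (Fin 2) (Fin 2) ℂ)).det ≠ 0)
    (Φ : MvPolynomial (Fin 3 × Fin N) ℂ) (hΦ : Φ ≠ 0) :
    ∃ u : Fin 3 × Fin N → ℂ, eval u Φ ≠ 0 ∧
      ∃ F' : Finset (Fin N → ℂ),
        (↑F' : Set (Fin N → ℂ)) ⊆
            polarSet g (fun i => u (0, i)) (fun i => u (1, i)) (fun i => u (2, i)) ∧
          F.card ≤ F'.card := by
  classical
  -- the base datum `u₀ = (a, b, c)`
  set u₀ : Fin 3 × Fin N → ℂ := fun p => ![a p.2, b p.2, c p.2] p.1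
  have ha : ∀ i, u₀ (0, i) = a i := fun i => rfl
  have hb : ∀ i, u₀ (1, i) = b i := fun i => rfl
  have hc : ∀ i, u₀ (2, i) = c i := fun i => rfl
  -- one continuous branch of polar points through each point of `F`
  have key : ∀ x ∈ F, ∃ φ : (Fin 3 × Fin N → ℂ) → (Fin N → ℂ), Tendsto φ (𝓝 u₀) (𝓝 x) ∧
      ∀ᶠ u in 𝓝 u₀,
        φ u ∈ polarSet g (fun i => u (0, i)) (fun i => u (1, i)) (fun i => u (2, i)) := by
    intro x hx
    obtain ⟨hmem, hdet⟩ := hF x hx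
    refine exists_branch g u₀ x ?_ ?_
    · simp only [ha, hb, hc]
      exact hmem
    · simp only [ha, hb, hc]
      exact hdet
  choose! φ hφt hφm using key
  -- near `u₀` all branches are polar points and pairwise distinct
  have hev₁ : ∀ᶠ u in 𝓝 u₀, ∀ x ∈ F,
      φ x u ∈ polarSet g (fun i => u (0, i)) (fun i => u (1, i)) (fun i => u (2, i)) :=
    (Filter.eventually_all_finset F).2 hφm
  have hev₂ : ∀ᶠ u in 𝓝 u₀, ∀ x ∈ F, ∀ x' ∈ F, x ≠ x' → φ x u ≠ φ x' u := by
    refine (Filter.eventually_all_finset F).2 fun x hx =>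
      (Filter.eventually_all_finset F).2 fun x' hx' => ?_
    by_cases hxx' : x = x'
    · exact Filter.Eventually.of_forall fun u h => (h hxx').elim
    · exact (((hφt x hx).prodMk_nhds (hφt x' hx')).eventually
        ((isOpen_ne_fun continuous_fst continuous_snd).mem_nhds hxx')).mono fun u h _ => h
  -- a good datum off `Φ = 0`
  obtain ⟨u, ⟨h₁, h₂⟩, hu⟩ :=
    ((hev₁.and hev₂).and_frequently (frequently_eval_ne_zero Φ hΦ u₀)).exists
  refine ⟨u, hu, F.image fun x => φ x u, ?_, ?_⟩
  · intro y hy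
    rw [Finset.coe_image] at hy
    obtain ⟨x, hx, rfl⟩ := hy
    exact h₁ x hx
  · rw [Finset.card_image_of_injOn fun x hx x' hx' h =>
      by_contra fun hne => h₂ x hx x' hx' hne h]

end Summit.ValiantsHypothesis.ValiantsHypothesis.Theorems.DetQPDetqpSuperquadratic
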